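import Mathlib
import Summits.NavierStokesRegularity.NavierStokesRegularity.Theorems.HeteroclinicTriggerChainTriggerChainFrontStepLatticeCapture
import HarnessLib

/-!
# `HeteroclinicTriggerChain` — crux `TriggerChainFrontStep` (item stmt-NavierStokesRegularity-22785):
  RECEIVER CONTENT at capture on the lattice (the amplitude ratio of the step)

Companion to `…LatticeCapture`. For an exact flow `S` of `α₀ + βσ` (normal form at `i₀`, parity at
`i₁`, `g = e`, `|α₀| ≤ 1`) the SUM of the two carriers `Σ = S_{i₀,0} + S_{i₀,1}` drifts only by the
remainders — the trigger's drain `−eu²` of shell `0` and pump `+gu²` into shell `1` cancel exactly when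
`g = e` (`…CarrierRow`): `|Σ(t) − Σ(0)| ≤ φ₁·t`, `φ₁ = 40ι² + 2ω² + 16V² + 2βB_σ` (`htcLR_sum_drift`).
Hence at a capture time (`S_{i₀,0} − S_{i₀,1} ≤ −L`, supplied by `htcLC_lattice_capture`) the receiver
holds `2·S_{i₀,1}(t) ≥ S_{i₀,0}(0) + S_{i₀,1}(0) + L − φ₁t` (`htcLR_receiver_at_capture`) — the amplitude
available for the ratio `a ≥ 2^{−θ₀}` of the checkpoint step (`TaoCascade.StepTo`).

HONEST FRAMING: a statement about exact flows of Tao-type MODEL lattices (Tao 2016 §4) under envelope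
hypotheses; helper for the crux (no stub credit); nothing here is a statement about the Navier–Stokes
equations; no summit, rung or crux is proved.
-/

noncomputable section

set_option linter.dupNamespace false

open Real Set

namespace Summit.NavierStokesRegularity.NavierStokesRegularity.Theorems

open Literature.Analysis.FluidPDE Literature.Analysis.FluidPDE.TaoCascade

/-- **Drift of the carrier sum.** Setting of the module docstring: on `[0,T]`,
`|(S_{i₀,0} + S_{i₀,1})(t) − (S_{i₀,0} + S_{i₀,1})(0)| ≤ (40ι² + 2ω² + 16V² + 2βB_σ)·t`. [this file] -/
theorem htcLR_sum_drift (α₀ σ : Fin 4 → Fin 4 → Fin 4 → ℤ × ℤ × ℤ → ℝ) (i₀ i₁ : Fin 4)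
    (d : Fin 4 → ℤ → ℝ) (hne : i₀ ≠ i₁)
    (hsym : IsSymmetricCoeff α₀) (hcanc : IsCancellingCoeff α₀)
    (hpure : ∀ X : Fin 4 → ℤ → ℝ → ℝ, (∀ i n t, i ≠ i₀ → X i n t = 0) →
      ∀ i n t, quadTerm 1 α₀ X i n t = 0)
    (hsad : ∀ (Y : Fin 4 → ℤ → ℝ → ℝ) (i : Fin 4) (n : ℤ) (t : ℝ),
      quadTerm 1 α₀ (fun j m s => (fun j m (_ : ℝ) => if j = i₀ ∧ m = 0 then (1 : ℝ) else 0) j m s +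
          Y j m s) i n t -
        quadTerm 1 α₀ (fun j m (_ : ℝ) => if j = i₀ ∧ m = 0 then (1 : ℝ) else 0) i n t -
        quadTerm 1 α₀ Y i n t = d i n * Y i n t)
    (hα1 : ∀ a b c μ, |α₀ a b c μ| ≤ 1)
    (hg : α₀ i₁ i₁ i₀ (0, 0, 1) = d i₁ 0) (he : 0 < d i₁ 0)
    (β : ℝ) (hβ : 0 ≤ β) (S : Fin 4 → ℤ → ℝ → ℝ) {T : ℝ}
    (hS : ∀ i k, ∀ t ∈ Icc 0 T, HasDerivWithinAt (S i k)
      (quadTerm 1 α₀ S i k t + β * quadTerm 1 σ S i k t) (Icc 0 T) t)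
    {V ι ω Bσ : ℝ} (hι0 : 0 ≤ ι)
    (hV : ∀ t ∈ Icc 0 T, |S i₁ 1 t| ≤ V) (hω : ∀ t ∈ Icc 0 T, |S i₁ (-1) t| ≤ ω)
    (hι : ∀ t ∈ Icc 0 T, ∀ a, a ≠ i₀ → a ≠ i₁ → |S a 0 t| ≤ ι ∧ |S a 1 t| ≤ ι ∧ |S a (-1) t| ≤ ι)
    (hBσ : ∀ t ∈ Icc 0 T, |quadTerm 1 σ S i₀ 0 t| ≤ Bσ ∧ |quadTerm 1 σ S i₀ 1 t| ≤ Bσ) :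
    ∀ t ∈ Icc 0 T, |(S i₀ 0 t + S i₀ 1 t) - (S i₀ 0 0 + S i₀ 1 0)| ≤
      (40 * ι ^ 2 + 2 * ω ^ 2 + 16 * V ^ 2 + 2 * β * Bσ) * t := by
  obtain ⟨nf1, -, -, nf4, -, -, nf7, -, -⟩ :=
    HeteroclinicTriggerChain.stub_normal_form α₀ i₀ d hsym hcanc hpure hsad
  have m001 : ((0 : ℤ), (0 : ℤ), (1 : ℤ)) ∈ shiftSet := by decide
  have hg0 : α₀ i₀ i₀ i₀ (0, 0, 1) = 0 := nf1 i₀ (0, 0, 1) m001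
  have hd0 : d i₀ 0 = 0 := nf7 0
  have he2 : d i₁ 0 ≤ 2 := by
    rw [nf4 i₁]; have := (abs_le.1 (hα1 i₀ i₁ i₁ (0, 0, 0))).2; linarith
  have hda : ∀ a, |d a 0| ≤ 2 := fun a => by
    rw [nf4 a, abs_mul, abs_two]; linarith [hα1 i₀ a a (0, 0, 0)]
  have hc₁0 : (0 : ℝ) ≤ (2 : ℝ) ^ (-((5 : ℝ) / 2)) := Real.rpow_nonneg (by norm_num) _
  have hc₁1 : (2 : ℝ) ^ (-((5 : ℝ) / 2)) ≤ 1 :=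
    Real.rpow_le_one_of_one_le_of_nonpos (by norm_num) (by norm_num)
  have hc₂0 : (0 : ℝ) ≤ (2 : ℝ) ^ ((5 : ℝ) / 2) := Real.rpow_nonneg (by norm_num) _
  have hc₂8 : (2 : ℝ) ^ ((5 : ℝ) / 2) ≤ 8 := by
    have h1 : (2 : ℝ) ^ ((5 : ℝ) / 2) ≤ (2 : ℝ) ^ (3 : ℝ) :=
      Real.rpow_le_rpow_of_exponent_le (by norm_num) (by norm_num)
    have h2 : (2 : ℝ) ^ (3 : ℝ) = 8 := by
      rw [show (3 : ℝ) = ((3 : ℕ) : ℝ) by norm_num, Real.rpow_natCast]; norm_num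
    linarith
  -- derivative of the sum
  have hSum : ∀ t ∈ Icc 0 T, HasDerivWithinAt (fun t => S i₀ 0 t + S i₀ 1 t)
      ((quadTerm 1 α₀ S i₀ 0 t + β * quadTerm 1 σ S i₀ 0 t) +
        (quadTerm 1 α₀ S i₀ 1 t + β * quadTerm 1 σ S i₀ 1 t)) (Icc 0 T) t := fun t ht =>
    (hS i₀ 0 t ht).add (hS i₀ 1 t ht)
  -- pointwise bound on the derivative
  have hbound : ∀ t ∈ Ico 0 T, ‖(quadTerm 1 α₀ S i₀ 0 t + β * quadTerm 1 σ S i₀ 0 t) +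
      (quadTerm 1 α₀ S i₀ 1 t + β * quadTerm 1 σ S i₀ 1 t)‖ ≤
      40 * ι ^ 2 + 2 * ω ^ 2 + 16 * V ^ 2 + 2 * β * Bσ := by
    intro t ht'
    have ht : t ∈ Icc 0 T := Ico_subset_Icc_self ht'
    rw [Real.norm_eq_abs]
    have hx := htcCR_quadTerm_carrier_zero α₀ i₀ d hsym hcanc hpure hsad S t
    have hy := htcCR_quadTerm_carrier_one α₀ i₀ d hsym hcanc hpure hsad S t
    have hjunk0 : ∀ a, a ≠ i₀ → a ≠ i₁ → |S a 0 t| ≤ ι := fun a h0 h1 => (hι t ht a h0 h1).1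
    have hjunk1 : ∀ a, a ≠ i₀ → a ≠ i₁ → |S a 1 t| ≤ ι := fun a h0 h1 => (hι t ht a h0 h1).2.1
    have hjunkm : ∀ a, a ≠ i₀ → a ≠ i₁ → |S a (-1) t| ≤ ι := fun a h0 h1 => (hι t ht a h0 h1).2.2
    have hsq : ∀ {z : ℝ}, |z| ≤ ι → z ^ 2 ≤ ι ^ 2 := fun {z} hz => by
      have := abs_nonneg z; nlinarith [sq_abs z]
    have hjd : ∀ (a : Fin 4) (z : ℝ), |z| ≤ ι → |d a 0 * z ^ 2| ≤ 2 * ι ^ 2 := fun a z hz => by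
      rw [abs_mul, abs_of_nonneg (sq_nonneg z)]
      exact mul_le_mul (hda a) (hsq hz) (sq_nonneg _) (by norm_num)
    have hjg : ∀ (a : Fin 4) (z : ℝ), |z| ≤ ι → |α₀ a a i₀ (0, 0, 1) * z ^ 2| ≤ ι ^ 2 := fun a z hz => by
      rw [abs_mul, abs_of_nonneg (sq_nonneg z)]
      calc |α₀ a a i₀ (0, 0, 1)| * z ^ 2 ≤ 1 * ι ^ 2 :=
          mul_le_mul (hα1 a a i₀ _) (hsq hz) (sq_nonneg _) (by norm_num)
        _ = ι ^ 2 := one_mul _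
    set R₁ : ℝ := ∑ a, d a 0 * S a 0 t ^ 2 - d i₁ 0 * S i₁ 0 t ^ 2 with hR₁
    set R₂ : ℝ := ∑ a, α₀ a a i₀ (0, 0, 1) * S a (-1) t ^ 2 - d i₁ 0 * S i₁ (-1) t ^ 2 with hR₂
    set R₃ : ℝ := ∑ a, d a 0 * S a 1 t ^ 2 - d i₁ 0 * S i₁ 1 t ^ 2 with hR₃
    set R₄ : ℝ := ∑ a, α₀ a a i₀ (0, 0, 1) * S a 0 t ^ 2 - d i₁ 0 * S i₁ 0 t ^ 2 with hR₄
    have hB₁ : |R₁| ≤ 4 * ι ^ 2 := by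
      have h := htcLC_sum_split (fun a => d a 0 * S a 0 t ^ 2) hne (B := 2 * ι ^ 2)
        (fun a h0 h1 => hjd a _ (hjunk0 a h0 h1))
      have key : R₁ = ∑ a, d a 0 * S a 0 t ^ 2 - d i₀ 0 * S i₀ 0 t ^ 2 - d i₁ 0 * S i₁ 0 t ^ 2 := by
        rw [hR₁, hd0]; ring
      rw [key]; linarith
    have hB₂ : |R₂| ≤ 2 * ι ^ 2 := by
      have h := htcLC_sum_split (fun a => α₀ a a i₀ (0, 0, 1) * S a (-1) t ^ 2) hne (B := ι ^ 2)
        (fun a h0 h1 => hjg a _ (hjunkm a h0 h1))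
      have key : R₂ = ∑ a, α₀ a a i₀ (0, 0, 1) * S a (-1) t ^ 2 -
          α₀ i₀ i₀ i₀ (0, 0, 1) * S i₀ (-1) t ^ 2 - α₀ i₁ i₁ i₀ (0, 0, 1) * S i₁ (-1) t ^ 2 := by
        rw [hR₂, hg0, hg]; ring
      rw [key]; linarith
    have hB₃ : |R₃| ≤ 4 * ι ^ 2 := by
      have h := htcLC_sum_split (fun a => d a 0 * S a 1 t ^ 2) hne (B := 2 * ι ^ 2)
        (fun a h0 h1 => hjd a _ (hjunk1 a h0 h1))
      have key : R₃ = ∑ a, d a 0 * S a 1 t ^ 2 - d i₀ 0 * S i₀ 1 t ^ 2 - d i₁ 0 * S i₁ 1 t ^ 2 := by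
        rw [hR₃, hd0]; ring
      rw [key]; linarith
    have hB₄ : |R₄| ≤ 2 * ι ^ 2 := by
      have h := htcLC_sum_split (fun a => α₀ a a i₀ (0, 0, 1) * S a 0 t ^ 2) hne (B := ι ^ 2)
        (fun a h0 h1 => hjg a _ (hjunk0 a h0 h1))
      have key : R₄ = ∑ a, α₀ a a i₀ (0, 0, 1) * S a 0 t ^ 2 -
          α₀ i₀ i₀ i₀ (0, 0, 1) * S i₀ 0 t ^ 2 - α₀ i₁ i₁ i₀ (0, 0, 1) * S i₁ 0 t ^ 2 := by
        rw [hR₄, hg0, hg]; ring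
      rw [key]; linarith
    have hΔ : |quadTerm 1 σ S i₀ 0 t + quadTerm 1 σ S i₀ 1 t| ≤ 2 * Bσ := by
      calc _ ≤ |quadTerm 1 σ S i₀ 0 t| + |quadTerm 1 σ S i₀ 1 t| := abs_add_le _ _
        _ ≤ 2 * Bσ := by linarith [(hBσ t ht).1, (hBσ t ht).2]
    -- the drain of shell 0 and the pump of shell 1 cancel (g = e)
    have heq : (quadTerm 1 α₀ S i₀ 0 t + β * quadTerm 1 σ S i₀ 0 t) +
        (quadTerm 1 α₀ S i₀ 1 t + β * quadTerm 1 σ S i₀ 1 t) =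
        -R₁ + (2 : ℝ) ^ (-((5 : ℝ) / 2)) * (d i₁ 0 * S i₁ (-1) t ^ 2 + R₂) -
          (2 : ℝ) ^ ((5 : ℝ) / 2) * (d i₁ 0 * S i₁ 1 t ^ 2 + R₃) + R₄ +
          β * (quadTerm 1 σ S i₀ 0 t + quadTerm 1 σ S i₀ 1 t) := by
      rw [hx, hy, hR₁, hR₂, hR₃, hR₄]; ring
    rw [heq]
    -- term bounds
    have hw2 : S i₁ (-1) t ^ 2 ≤ ω ^ 2 := by
      have := hω t ht; have := abs_nonneg (S i₁ (-1) t); nlinarith [sq_abs (S i₁ (-1) t)]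
    have hv2 : S i₁ 1 t ^ 2 ≤ V ^ 2 := by
      have := hV t ht; have := abs_nonneg (S i₁ 1 t); nlinarith [sq_abs (S i₁ 1 t)]
    have h2 : |(2 : ℝ) ^ (-((5 : ℝ) / 2)) * (d i₁ 0 * S i₁ (-1) t ^ 2 + R₂)| ≤ 2 * ω ^ 2 + 2 * ι ^ 2 := by
      rw [abs_mul, abs_of_nonneg hc₁0]
      have hin : |d i₁ 0 * S i₁ (-1) t ^ 2 + R₂| ≤ 2 * ω ^ 2 + 2 * ι ^ 2 := by
        have hp : d i₁ 0 * S i₁ (-1) t ^ 2 ≤ 2 * ω ^ 2 := mul_le_mul he2 hw2 (sq_nonneg _) (by norm_num)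
        have hnn : 0 ≤ d i₁ 0 * S i₁ (-1) t ^ 2 := mul_nonneg he.le (sq_nonneg _)
        calc _ ≤ |d i₁ 0 * S i₁ (-1) t ^ 2| + |R₂| := abs_add_le _ _
          _ ≤ _ := by rw [abs_of_nonneg hnn]; linarith
      calc _ ≤ 1 * |d i₁ 0 * S i₁ (-1) t ^ 2 + R₂| := mul_le_mul_of_nonneg_right hc₁1 (abs_nonneg _)
        _ ≤ _ := by linarith
    have h3 : |(2 : ℝ) ^ ((5 : ℝ) / 2) * (d i₁ 0 * S i₁ 1 t ^ 2 + R₃)| ≤ 16 * V ^ 2 + 32 * ι ^ 2 := by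
      rw [abs_mul, abs_of_nonneg hc₂0]
      have hin : |d i₁ 0 * S i₁ 1 t ^ 2 + R₃| ≤ 2 * V ^ 2 + 4 * ι ^ 2 := by
        have hp : d i₁ 0 * S i₁ 1 t ^ 2 ≤ 2 * V ^ 2 := mul_le_mul he2 hv2 (sq_nonneg _) (by norm_num)
        have hnn : 0 ≤ d i₁ 0 * S i₁ 1 t ^ 2 := mul_nonneg he.le (sq_nonneg _)
        calc _ ≤ |d i₁ 0 * S i₁ 1 t ^ 2| + |R₃| := abs_add_le _ _
          _ ≤ _ := by rw [abs_of_nonneg hnn]; linarith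
      calc _ ≤ 8 * |d i₁ 0 * S i₁ 1 t ^ 2 + R₃| := mul_le_mul_of_nonneg_right hc₂8 (abs_nonneg _)
        _ ≤ _ := by linarith
    have h5 : |β * (quadTerm 1 σ S i₀ 0 t + quadTerm 1 σ S i₀ 1 t)| ≤ 2 * β * Bσ := by
      rw [abs_mul, abs_of_nonneg hβ]
      have := mul_le_mul_of_nonneg_left hΔ hβ
      linarith
    set X := (2 : ℝ) ^ (-((5 : ℝ) / 2)) * (d i₁ 0 * S i₁ (-1) t ^ 2 + R₂) with hX
    set Y := (2 : ℝ) ^ ((5 : ℝ) / 2) * (d i₁ 0 * S i₁ 1 t ^ 2 + R₃) with hY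
    set Z := β * (quadTerm 1 σ S i₀ 0 t + quadTerm 1 σ S i₀ 1 t) with hZ
    calc |-R₁ + X - Y + R₄ + Z| ≤ |-R₁ + X - Y + R₄| + |Z| := abs_add_le _ _
      _ ≤ |-R₁ + X - Y| + |R₄| + |Z| := by linarith [abs_add_le (-R₁ + X - Y) R₄]
      _ ≤ |-R₁ + X| + |Y| + |R₄| + |Z| := by linarith [abs_sub (-R₁ + X) Y]
      _ ≤ |-R₁| + |X| + |Y| + |R₄| + |Z| := by linarith [abs_add_le (-R₁) X]
      _ ≤ 4 * ι ^ 2 + (2 * ω ^ 2 + 2 * ι ^ 2) + (16 * V ^ 2 + 32 * ι ^ 2) + 2 * ι ^ 2 + 2 * β * Bσ := by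
          rw [abs_neg]; linarith
      _ = 40 * ι ^ 2 + 2 * ω ^ 2 + 16 * V ^ 2 + 2 * β * Bσ := by ring
  intro t ht
  have h := norm_image_sub_le_of_norm_deriv_le_segment' hSum hbound t ht
  rw [Real.norm_eq_abs, sub_zero] at h
  exact h

/-- **Receiver content at capture.** In the setting of `htcLR_sum_drift`, at any time `t ∈ [0,T]` with
`S_{i₀,0}(t) − S_{i₀,1}(t) ≤ −L`: `2·S_{i₀,1}(t) ≥ S_{i₀,0}(0) + S_{i₀,1}(0) + L − φ₁·t`,
`φ₁ = 40ι² + 2ω² + 16V² + 2βB_σ`. [this file] -/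
theorem htcLR_receiver_at_capture {x0 y0 xt yt L φ₁ t : ℝ}
    (hdrift : |(xt + yt) - (x0 + y0)| ≤ φ₁ * t) (hcap : xt - yt ≤ -L) :
    x0 + y0 + L - φ₁ * t ≤ 2 * yt := by
  have h := (abs_le.1 hdrift).1
  linarith

end Summit.NavierStokesRegularity.NavierStokesRegularity.Theorems

end
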